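import Summits.QuantumFields.YangMills.Theorems.BalabanUVNodesN15KingModelToronHolonomyGap
import Summits.QuantumFields.YangMills.Theorems.BalabanUVNodesN15KingModelToronResolvent
import HarnessLib

/-!
# BalabanUVNodes ∕ N15 — THE KING-MODEL RUNG (PART Ͷ-e): THE MASSLESS TORON COVARIANCE — at non-trivial holonomy `θ ≠ 0` the massless twisted Laplacian `−cΔ_ω` IS invertible
# (King's own massless operator is not), `(−cΔ_ω)⁻¹ = |T|⁻¹Σ_q e^{iq·(x−y)}∕(cΣ_μ(2−2cos(p′_μ(q)+θ_μ∕K_μ)))`, and `‖(−cΔ_ω + m²)⁻¹‖_{ℓ²→ℓ²} = 1∕(m² + holonomyGap(θ))` EXACTLY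
# ('t Hooft's twist as an infrared regulator in the toy: `‖(−cΔ_ω)⁻¹‖ ∈ [K²-scale∕(cθ²)·1, ·π²∕4]`)
# (Track A, DAG node N15 = NE2; FAN-OUT v1.1 §N15 s3 «KING-MODEL RUNG … + what the curved case adds»; count-neutral)

HONEST FRAMING.  Count-neutral (cell `pub-ymgap`, seat `pub-ymgap-dag-n15-e` g44; `--supports stmt-QuantumFields-27247 --as helper` = K3ᴬ, KEY MAP v3).  One finite torus at
fixed spacing; King's `A = 0` model [King1986] is the comparison object (massless: singular, the constants are zero modes — PART Ͱ-d `not_posDef_covLapF_massless_free`); constant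
abelian `U(1)` link fields with reduced holonomy angles `|θ_μ| ≤ π`.  NOT Bałaban's `G_k(U)`, NOT [Balaban1985BackgroundPropagators] (3.42); NOT a node discharge; nothing continuum ∕
ℝ⁴ ∕ OS ∕ Clay.

THE RESULTS (`M = toronOp K c m² (e^{iθ∕K})`, `λ₀ := m² + holonomyGap K c θ` of PART Ͷ-d):
* §1 the plane-wave inverse under POSITIVITY OF THE SYMBOL only: `toronOp_mul_toronKernel_of_pos`, ★ `toronOp_inv_eq_toronKernel_of_pos` (PART Ͷ-b had `m² > 0`);
* §2 THE MASSLESS TORON: `lapSymTw_massless_pos` (`θ ≠ 0 ⇒` every symbol value `> 0`, `c > 0`), ★★ `isUnit_toronOp_massless`, ★★★ **`toronOp_massless_inv_eq_toronKernel`** —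
  `(−cΔ_ω)⁻¹(x,y) = |T|⁻¹Σ_q e^{iq·(x−y)}∕(cΣ_μ(2 − 2cos(p′_μ(q) + θ_μ∕K_μ)))` (no mass: the holonomy regulates the zero mode), ★ `not_isUnit_toronOp_massless_zero` (at `θ = 0` — King's
  operator — it is singular);
* §3 THE OPERATOR NORM OF THE COVARIANCE, EXACTLY: `toronOp_mulVec_one` (`M·1 = λ₀·1`), `sum_norm_sq_eq_norm_toLp_sq`, `re_star_dotProduct_le_norm_mul_norm`, ★★ `norm_toLp_toronOp_inv_mulVec_le`
  (`‖M⁻¹w‖ ≤ λ₀⁻¹‖w‖`, `λ₀ > 0`), ★★★ **`l2_opNorm_toronOp_inv_eq`** — `‖M⁻¹‖_{ℓ²→ℓ²} = 1∕(m² + holonomyGap(θ))` whenever `m² + holonomyGap > 0` (upper bound by coercivity, lower bound on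
  the constants); in particular ★★★ **`l2_opNorm_toronOp_massless_inv_eq`** — `‖(−cΔ_ω)⁻¹‖ = 1∕holonomyGap(θ) = 1∕(2cΣ_μ(1 − cos(θ_μ∕K_μ)))` (`θ ≠ 0`), with the two-sided infrared
  bounds ★★ `l2_opNorm_toronOp_massless_inv_le`∕`_ge`: `1∕(cΣ_μ(θ_μ∕K_μ)²) ≤ ‖(−cΔ_ω)⁻¹‖ ≤ π²∕(4cΣ_μ(θ_μ∕K_μ)²)` — the massless toron covariance is of INFRARED size
  `(K∕θ)²∕c` (in physical units `(ℓ∕θ)²`), blowing up exactly quadratically as the holonomy is switched off;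
* §4 SPECTRUM: ★ `hasEigenvector_toronOp_const` (the constants, eigenvalue `λ₀`), `hasEigenvalue_toronOp_gap`, ★★ `eigenvalues_toronOp_ge` (every eigenvalue of `M` is `≥ λ₀`;
  Mathlib's `IsHermitian.eigenvalues`).

PRIOR TREE ART (by name, not restated): Ͷ-a (`toronOp`, `toronOp_mulVec_chi`, `toronOp_isHermitian`, `form_toronOp_im`), Ͷ-b (`toronKernel`, `card_tor_ne_zero`), Ͷ-d (`holonomyGap`,
`redPhase`, `holonomyGap_le_lapSymTw`, `holonomyGap_pos_iff`, `holonomyGap_nonneg`, `form_toronOp_ge_holonomyGap`, `lapSymTw_reduced_zero`, `chi_zero_eq_one`, `holonomyGap_ge_sq`,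
`holonomyGap_le_sq`, `toronOp_massless_posDef_iff`), `B5Prop11Plancherel` (`chi`, `chi_add_right`, `sum_chi_left` via `King1986.Torus`), Mathlib (`Matrix.Norms.L2Operator`:
`Matrix.cstar_norm_def`, `Matrix.toEuclideanCLM_toLp`, `ContinuousLinearMap.opNorm_le_bound`, `ContinuousLinearMap.le_opNorm`; `Matrix.IsHermitian.eigenvalues_eq`,
`Module.End.hasEigenvalue_of_hasEigenvector`).  Dedup (rg at filing): basename 0 files; needles `toronOp_massless_inv|l2_opNorm_toronOp|eigenvalues_toronOp_ge|toronOp_mulVec_one` 0 tree files;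
Ͱ-f's `re_star_dotProduct_le_norm_mul_norm`∕`norm_toLp_inv_mulVec_le` are the `T × n`-carrier analogues (different types; the `T → ℂ` versions here are three-line restatements of
Cauchy–Schwarz, named with a `'`).  Locators: [King1986] (4.4) p.670, (4.35) p.674; [Balaban1985BackgroundPropagators] (3.23) p.394, (3.46) p.398; [DodziukMathai2006] §1 Cor 1.3;
[tHooft1979Flux] NPB 153 (twisted boundary conditions; notion only).  0 `sorry`, 0 `def`.
-/

noncomputable section

open scoped BigOperators ComplexConjugate ComplexOrder InnerProductSpace
open Finset Matrix Complex WithLp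

namespace Summit.QuantumFields.YangMills.BalabanUVNodes.N15KingModelRung.Toron

open Literature.MathematicalPhysics.QuantumFieldTheory.Balaban1983to89.B5Prop11Plancherel
open Literature.MathematicalPhysics.QuantumFieldTheory.Balaban1983to89.B5ToronMomentum161 (twistOf)
open Literature.MathematicalPhysics.QuantumFieldTheory.King1986.Torus (lapSym sum_chi_left)

variable {d : ℕ} (K : Fin (d + 1) → ℕ) [hK : ∀ μ, NeZero (K μ)]

/-! ## §1 The plane-wave inverse under positivity of the symbol -/

section PosSymbol

/-- `M·G = 1` whenever every value of the twisted symbol is positive (any `m²`, e.g. `m² = 0` at non-trivial holonomy). [cite: King1986, (4.35) p.674] -/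
theorem toronOp_mul_toronKernel_of_pos (c m2 : ℝ) (φ : Fin (d + 1) → ℝ) (hpos : ∀ q, 0 < lapSymTw K c m2 φ q) :
    toronOp K c m2 (twistOf φ) * Matrix.of (toronKernel K c m2 φ) = 1 := by
  ext x y
  rw [Matrix.mul_apply', Matrix.one_apply]
  have hcol : (fun z => Matrix.of (toronKernel K c m2 φ) z y)
      = ∑ q : Tor K, ((Fintype.card (Tor K) : ℂ)⁻¹ * (((lapSymTw K c m2 φ q)⁻¹ : ℝ) : ℂ) * chi K q (-y)) • chi K q := by
    funext z
    simp only [Matrix.of_apply, toronKernel, Finset.sum_apply, Pi.smul_apply, smul_eq_mul, Finset.mul_sum]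
    refine Finset.sum_congr rfl fun q _ => ?_
    rw [sub_eq_add_neg, chi_add_right]; ring
  have h : (toronOp K c m2 (twistOf φ) *ᵥ fun z => Matrix.of (toronKernel K c m2 φ) z y) x = if x = y then 1 else 0 := by
    rw [hcol, Matrix.mulVec_sum]
    simp_rw [Matrix.mulVec_smul, toronOp_mulVec_chi]
    simp only [Finset.sum_apply, Pi.smul_apply, smul_eq_mul]
    have hq : ∀ q : Tor K, (Fintype.card (Tor K) : ℂ)⁻¹ * (((lapSymTw K c m2 φ q)⁻¹ : ℝ) : ℂ) * chi K q (-y) * (((lapSymTw K c m2 φ q : ℝ) : ℂ) * chi K q x)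
        = (Fintype.card (Tor K) : ℂ)⁻¹ * chi K q (x - y) := by
      intro q
      have hne : ((lapSymTw K c m2 φ q : ℝ) : ℂ) ≠ 0 := by exact_mod_cast (hpos q).ne'
      rw [sub_eq_add_neg, chi_add_right]
      push_cast
      field_simp
    simp_rw [hq]
    rw [← Finset.mul_sum, sum_chi_left]
    by_cases hxy : x = y
    · subst hxy; rw [sub_self, if_pos rfl, if_pos rfl, inv_mul_cancel₀ (card_tor_ne_zero K)]
    · rw [if_neg (sub_ne_zero.mpr hxy), if_neg hxy, mul_zero]
  simpa only [Matrix.mulVec, dotProduct] using h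

/-- ★ `M⁻¹ = (|T|⁻¹Σ_q lapSymTw(φ,q)⁻¹e^{iq·(x−y)})` under positivity of the symbol only. [cite: King1986, (4.35) p.674] -/
theorem toronOp_inv_eq_toronKernel_of_pos (c m2 : ℝ) (φ : Fin (d + 1) → ℝ) (hpos : ∀ q, 0 < lapSymTw K c m2 φ q) :
    (toronOp K c m2 (twistOf φ))⁻¹ = Matrix.of (toronKernel K c m2 φ) :=
  Matrix.inv_eq_right_inv (toronOp_mul_toronKernel_of_pos K c m2 φ hpos)

end PosSymbol

/-! ## §2 The massless toron at non-trivial holonomy -/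

section Massless

/-- `θ ≠ 0` (reduced angles, `c > 0`) ⟹ every value of the MASSLESS twisted symbol is positive: `cΣ_μ(2 − 2cos(p′_μ(q) + θ_μ∕K_μ)) ≥ holonomyGap > 0`. [cite: King1986, (4.4) p.670] -/
theorem lapSymTw_massless_pos {c : ℝ} (hc : 0 < c) {θ : Fin (d + 1) → ℝ} (hθ : ∀ μ, |θ μ| ≤ Real.pi) (hne : θ ≠ 0) (q : Tor K) :
    0 < lapSymTw K c 0 (redPhase K θ) q :=
  lt_of_lt_of_le (by have := (holonomyGap_pos_iff K hc hθ).mpr hne; linarith) (holonomyGap_le_lapSymTw K hc.le 0 hθ q)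

/-- ★★ **THE MASSLESS TORON LAPLACIAN IS INVERTIBLE** at non-trivial holonomy (`c > 0`, reduced `θ ≠ 0`). [cite: DodziukMathai2006, §1 Cor 1.3; Balaban1985BackgroundPropagators, (3.23) p.394] -/
theorem isUnit_toronOp_massless {c : ℝ} (hc : 0 < c) {θ : Fin (d + 1) → ℝ} (hθ : ∀ μ, |θ μ| ≤ Real.pi) (hne : θ ≠ 0) :
    IsUnit (toronOp K c 0 (twistOf (redPhase K θ))) :=
  ((toronOp_massless_posDef_iff K hc hθ).mpr hne).isUnit

/-- ★★★ **THE MASSLESS TORON COVARIANCE IN TWISTED PLANE WAVES**: `(−cΔ_ω)⁻¹(x,y) = |T|⁻¹Σ_q e^{iq·(x−y)}∕(cΣ_μ(2 − 2cos(p′_μ(q) + θ_μ∕K_μ)))` (`θ ≠ 0` reduced, `c > 0`) —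
no mass is needed: the holonomy regulates King's zero mode. [cite: King1986, (4.35) p.674; tHooft1979Flux, NPB 153 (twisted b.c. as infrared regulator)] -/
theorem toronOp_massless_inv_eq_toronKernel {c : ℝ} (hc : 0 < c) {θ : Fin (d + 1) → ℝ} (hθ : ∀ μ, |θ μ| ≤ Real.pi) (hne : θ ≠ 0) :
    (toronOp K c 0 (twistOf (redPhase K θ)))⁻¹ = Matrix.of (toronKernel K c 0 (redPhase K θ)) :=
  toronOp_inv_eq_toronKernel_of_pos K c 0 _ (lapSymTw_massless_pos K hc hθ hne)

/-- `(−cΔ_ω)·(−cΔ_ω)⁻¹ = 1` (`θ ≠ 0`). [folklore] -/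
theorem toronOp_massless_mul_inv {c : ℝ} (hc : 0 < c) {θ : Fin (d + 1) → ℝ} (hθ : ∀ μ, |θ μ| ≤ Real.pi) (hne : θ ≠ 0) :
    toronOp K c 0 (twistOf (redPhase K θ)) * (toronOp K c 0 (twistOf (redPhase K θ)))⁻¹ = 1 :=
  Matrix.mul_nonsing_inv _ ((Matrix.isUnit_iff_isUnit_det _).mp (isUnit_toronOp_massless K hc hθ hne))

/-- ★ AT TRIVIAL HOLONOMY THE MASSLESS OPERATOR — KING's `c(−Δ)` — IS SINGULAR (the constants are in the kernel). [cite: King1986, (4.4) p.670] -/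
theorem not_isUnit_toronOp_massless_zero (c : ℝ) : ¬ IsUnit (toronOp K c 0 (twistOf (redPhase K (0 : Fin (d + 1) → ℝ)))) := by
  intro hU
  have h1 : toronOp K c 0 (twistOf (redPhase K (0 : Fin (d + 1) → ℝ))) *ᵥ chi K 0 = 0 := by
    rw [toronOp_mulVec_chi, lapSymTw_reduced_zero]
    simp [holonomyGap]
  have hinj := Matrix.mulVec_injective_iff_isUnit.mpr hU
  have h0 : chi K (0 : Tor K) = 0 := hinj (by rw [h1, Matrix.mulVec_zero])
  have := congr_fun h0 0
  rw [chi_zero_left] at this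
  exact one_ne_zero this

omit hK in
/-- `θ ≠ 0 ⇒ Σ_μ(θ_μ∕K_μ)² > 0`. [folklore] -/
theorem sum_sq_redPhase_pos {θ : Fin (d + 1) → ℝ} (hne : θ ≠ 0) [hK : ∀ μ, NeZero (K μ)] : 0 < ∑ μ, (θ μ / K μ) ^ 2 := by
  obtain ⟨μ, hμ⟩ := Function.ne_iff.mp hne
  have hx : θ μ / K μ ≠ 0 := div_ne_zero hμ (period_pos K μ).ne'
  exact lt_of_lt_of_le (lt_of_le_of_ne (sq_nonneg _) (Ne.symm (pow_ne_zero 2 hx))) (Finset.single_le_sum (fun ν _ => sq_nonneg (θ ν / K ν)) (Finset.mem_univ μ))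

end Massless

/-! ## §3 The operator norm of the toron covariance, exactly -/

section OpNorm

/-- `M·1 = (m² + holonomyGap)·1`: the constants are an eigenvector of the toron operator (constant gauge). [cite: King1986, (4.4) p.670] -/
theorem toronOp_mulVec_one (c m2 : ℝ) (θ : Fin (d + 1) → ℝ) :
    toronOp K c m2 (twistOf (redPhase K θ)) *ᵥ (fun _ => (1 : ℂ)) = (((m2 + holonomyGap K c θ : ℝ)) : ℂ) • fun _ => (1 : ℂ) := by
  rw [← chi_zero_eq_one, toronOp_mulVec_chi, lapSymTw_reduced_zero]

/-- `M⁻¹·1 = (m² + holonomyGap)⁻¹·1` when `m² + holonomyGap ≠ 0` and `M` is invertible. [folklore] -/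
theorem toronOp_inv_mulVec_one (c m2 : ℝ) (θ : Fin (d + 1) → ℝ) (hU : IsUnit (toronOp K c m2 (twistOf (redPhase K θ)))) (hlam : m2 + holonomyGap K c θ ≠ 0) :
    (toronOp K c m2 (twistOf (redPhase K θ)))⁻¹ *ᵥ (fun _ => (1 : ℂ)) = ((((m2 + holonomyGap K c θ)⁻¹ : ℝ)) : ℂ) • fun _ => (1 : ℂ) := by
  have hdet : IsUnit (toronOp K c m2 (twistOf (redPhase K θ))).det := (Matrix.isUnit_iff_isUnit_det _).mp hU
  have h := toronOp_mulVec_one K c m2 θ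
  have h2 := congrArg (fun v => (toronOp K c m2 (twistOf (redPhase K θ)))⁻¹ *ᵥ v) h
  simp only [Matrix.mulVec_mulVec, Matrix.nonsing_inv_mul _ hdet, Matrix.one_mulVec, Matrix.mulVec_smul] at h2
  have hlamc : (((m2 + holonomyGap K c θ : ℝ)) : ℂ) ≠ 0 := by exact_mod_cast hlam
  rw [Complex.ofReal_inv, eq_inv_smul_iff₀ hlamc, ← h2]

/-- `Σ_x|v_x|² = ‖v‖²_{ℓ²(T)}`. [folklore] -/
theorem sum_norm_sq_eq_norm_toLp_sq (v : Tor K → ℂ) : ∑ x, ‖v x‖ ^ 2 = ‖(toLp 2 v : EuclideanSpace ℂ (Tor K))‖ ^ 2 := by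
  rw [EuclideanSpace.norm_eq (toLp 2 v), Real.sq_sqrt (Finset.sum_nonneg fun _ _ => sq_nonneg _)]

/-- Cauchy–Schwarz in `ℓ²(T)`: `Re(v^*·w) ≤ ‖v‖‖w‖`. [folklore] -/
theorem re_star_dotProduct_le_norm_mul_norm' (v w : Tor K → ℂ) :
    (star v ⬝ᵥ w).re ≤ ‖(toLp 2 v : EuclideanSpace ℂ (Tor K))‖ * ‖(toLp 2 w : EuclideanSpace ℂ (Tor K))‖ := by
  have h : star v ⬝ᵥ w = ⟪(toLp 2 v : EuclideanSpace ℂ (Tor K)), toLp 2 w⟫_ℂ := by rw [EuclideanSpace.inner_toLp_toLp, dotProduct_comm]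
  rw [h]
  exact (Complex.re_le_norm _).trans (norm_inner_le_norm _ _)

/-- ★★ **`‖M⁻¹w‖ ≤ (m² + holonomyGap)⁻¹‖w‖`** whenever `λ₀ = m² + holonomyGap > 0` (reduced angles, `c ≥ 0`; covers the massless toron at `θ ≠ 0` and every massive one): with
`v = M⁻¹w`, `λ₀‖v‖² ≤ Re(v^*Mv) = Re(v^*w) ≤ ‖v‖‖w‖`. [cite: Balaban1985BackgroundPropagators, (3.46) p.398; King1986, (4.35) p.674] -/
theorem norm_toLp_toronOp_inv_mulVec_le {c : ℝ} (hc : 0 ≤ c) (m2 : ℝ) {θ : Fin (d + 1) → ℝ} (hθ : ∀ μ, |θ μ| ≤ Real.pi) (hlam : 0 < m2 + holonomyGap K c θ)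
    (hU : IsUnit (toronOp K c m2 (twistOf (redPhase K θ)))) (w : Tor K → ℂ) :
    ‖(toLp 2 ((toronOp K c m2 (twistOf (redPhase K θ)))⁻¹ *ᵥ w) : EuclideanSpace ℂ (Tor K))‖
      ≤ (m2 + holonomyGap K c θ)⁻¹ * ‖(toLp 2 w : EuclideanSpace ℂ (Tor K))‖ := by
  have hdet : IsUnit (toronOp K c m2 (twistOf (redPhase K θ))).det := (Matrix.isUnit_iff_isUnit_det _).mp hU
  set v := (toronOp K c m2 (twistOf (redPhase K θ)))⁻¹ *ᵥ w with hv
  have hMv : toronOp K c m2 (twistOf (redPhase K θ)) *ᵥ v = w := by rw [hv, mulVec_mulVec, Matrix.mul_nonsing_inv _ hdet, one_mulVec]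
  have h1 := form_toronOp_ge_holonomyGap K hc m2 hθ v
  rw [hMv, sum_norm_sq_eq_norm_toLp_sq] at h1
  have h2 := re_star_dotProduct_le_norm_mul_norm' K v w
  set a := ‖(toLp 2 v : EuclideanSpace ℂ (Tor K))‖ with ha
  set b := ‖(toLp 2 w : EuclideanSpace ℂ (Tor K))‖ with hb
  have ha0 : 0 ≤ a := norm_nonneg _
  have hb0 : 0 ≤ b := norm_nonneg _
  rw [le_inv_mul_iff₀ hlam]
  by_cases hz : a = 0
  · rw [hz, mul_zero]; exact hb0
  · have hapos : 0 < a := lt_of_le_of_ne ha0 (Ne.symm hz)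
    nlinarith [h1, h2]

/-- Positive `λ₀` makes the toron operator invertible (coercivity). [folklore] -/
theorem isUnit_toronOp_of_gap_pos {c : ℝ} (hc : 0 ≤ c) (m2 : ℝ) {θ : Fin (d + 1) → ℝ} (hθ : ∀ μ, |θ μ| ≤ Real.pi) (hlam : 0 < m2 + holonomyGap K c θ) :
    IsUnit (toronOp K c m2 (twistOf (redPhase K θ))) := by
  refine (Matrix.PosDef.of_dotProduct_mulVec_pos (toronOp_isHermitian K c m2 _) fun v hv => ?_).isUnit
  have hform := form_toronOp_ge_holonomyGap K hc m2 hθ v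
  have hpos : 0 < ∑ x, ‖v x‖ ^ 2 := by
    obtain ⟨x, hx⟩ := Function.ne_iff.mp hv
    exact lt_of_lt_of_le (by positivity : 0 < ‖v x‖ ^ 2) (Finset.single_le_sum (fun y _ => sq_nonneg ‖v y‖) (Finset.mem_univ x))
  have hre : 0 < (star v ⬝ᵥ (toronOp K c m2 (twistOf (redPhase K θ)) *ᵥ v)).re := lt_of_lt_of_le (mul_pos hlam hpos) hform
  have him : (star v ⬝ᵥ (toronOp K c m2 (twistOf (redPhase K θ)) *ᵥ v)).im = 0 := form_toronOp_im K hc m2 _ v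
  exact (RCLike.pos_iff (K := ℂ)).mpr ⟨by simpa using hre, by simpa using him⟩

open scoped Matrix.Norms.L2Operator in
/-- ★★ `‖M⁻¹‖_{ℓ²→ℓ²} ≤ (m² + holonomyGap)⁻¹` (`λ₀ > 0`). [cite: Balaban1985BackgroundPropagators, (3.46) p.398] -/
theorem l2_opNorm_toronOp_inv_le {c : ℝ} (hc : 0 ≤ c) (m2 : ℝ) {θ : Fin (d + 1) → ℝ} (hθ : ∀ μ, |θ μ| ≤ Real.pi) (hlam : 0 < m2 + holonomyGap K c θ) :
    ‖(toronOp K c m2 (twistOf (redPhase K θ)))⁻¹‖ ≤ (m2 + holonomyGap K c θ)⁻¹ := by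
  rw [Matrix.cstar_norm_def]
  refine ContinuousLinearMap.opNorm_le_bound _ (inv_nonneg.2 hlam.le) fun w => ?_
  have hw : w = toLp 2 (ofLp w) := rfl
  rw [hw, Matrix.toEuclideanCLM_toLp]
  exact norm_toLp_toronOp_inv_mulVec_le K hc m2 hθ hlam (isUnit_toronOp_of_gap_pos K hc m2 hθ hlam) (ofLp w)

open scoped Matrix.Norms.L2Operator in
/-- ★★ `‖M⁻¹‖_{ℓ²→ℓ²} ≥ (m² + holonomyGap)⁻¹`: the constants realise the bound (`M⁻¹1 = λ₀⁻¹1`). [cite: King1986, (4.35) p.674] -/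
theorem l2_opNorm_toronOp_inv_ge {c : ℝ} (hc : 0 ≤ c) (m2 : ℝ) {θ : Fin (d + 1) → ℝ} (hθ : ∀ μ, |θ μ| ≤ Real.pi) (hlam : 0 < m2 + holonomyGap K c θ) :
    (m2 + holonomyGap K c θ)⁻¹ ≤ ‖(toronOp K c m2 (twistOf (redPhase K θ)))⁻¹‖ := by
  set M := toronOp K c m2 (twistOf (redPhase K θ)) with hM
  have hU : IsUnit M := isUnit_toronOp_of_gap_pos K hc m2 hθ hlam
  have hone : ‖(toLp 2 (fun _ : Tor K => (1 : ℂ)) : EuclideanSpace ℂ (Tor K))‖ ≠ 0 := by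
    rw [norm_ne_zero_iff]
    intro h
    have := congrArg (fun v : EuclideanSpace ℂ (Tor K) => v 0) h
    simp at this
  have h := (Matrix.toEuclideanCLM (𝕜 := ℂ) (n := Tor K) M⁻¹).le_opNorm (toLp 2 fun _ => (1 : ℂ))
  rw [Matrix.toEuclideanCLM_toLp, toronOp_inv_mulVec_one K c m2 θ hU hlam.ne', WithLp.toLp_smul, norm_smul, Complex.norm_real, Real.norm_eq_abs,
    abs_of_pos (inv_pos.mpr hlam), ← Matrix.cstar_norm_def] at h
  exact le_of_mul_le_mul_right h (lt_of_le_of_ne (norm_nonneg _) (Ne.symm hone))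

open scoped Matrix.Norms.L2Operator in
/-- ★★★ **THE OPERATOR NORM OF THE TORON COVARIANCE, EXACTLY**: `‖(−cΔ_ω + m²)⁻¹‖_{ℓ²→ℓ²} = 1∕(m² + 2cΣ_μ(1 − cos(θ_μ∕K_μ)))` whenever the right side is finite and positive
(reduced angles, `c ≥ 0`). [cite: King1986, (4.35) p.674; Balaban1985BackgroundPropagators, (3.46) p.398] -/
theorem l2_opNorm_toronOp_inv_eq {c : ℝ} (hc : 0 ≤ c) (m2 : ℝ) {θ : Fin (d + 1) → ℝ} (hθ : ∀ μ, |θ μ| ≤ Real.pi) (hlam : 0 < m2 + holonomyGap K c θ) :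
    ‖(toronOp K c m2 (twistOf (redPhase K θ)))⁻¹‖ = (m2 + holonomyGap K c θ)⁻¹ :=
  le_antisymm (l2_opNorm_toronOp_inv_le K hc m2 hθ hlam) (l2_opNorm_toronOp_inv_ge K hc m2 hθ hlam)

open scoped Matrix.Norms.L2Operator in
/-- ★★★ **THE MASSLESS TORON COVARIANCE HAS NORM `1∕holonomyGap`**: `‖(−cΔ_ω)⁻¹‖_{ℓ²→ℓ²} = 1∕(2cΣ_μ(1 − cos(θ_μ∕K_μ)))` (`θ ≠ 0` reduced, `c > 0`) — King's own massless operator has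
no inverse at all; the holonomy is the infrared regulator. [cite: tHooft1979Flux, NPB 153 (twisted boundary conditions); King1986, (4.4) p.670] -/
theorem l2_opNorm_toronOp_massless_inv_eq {c : ℝ} (hc : 0 < c) {θ : Fin (d + 1) → ℝ} (hθ : ∀ μ, |θ μ| ≤ Real.pi) (hne : θ ≠ 0) :
    ‖(toronOp K c 0 (twistOf (redPhase K θ)))⁻¹‖ = (holonomyGap K c θ)⁻¹ := by
  have h := l2_opNorm_toronOp_inv_eq K hc.le 0 hθ (by rw [zero_add]; exact (holonomyGap_pos_iff K hc hθ).mpr hne)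
  rwa [zero_add] at h

open scoped Matrix.Norms.L2Operator in
/-- ★★ INFRARED UPPER BOUND: `‖(−cΔ_ω)⁻¹‖ ≤ π²∕(4cΣ_μ(θ_μ∕K_μ)²)` (`θ ≠ 0` reduced, `c > 0`; Jordan). [cite: tHooft1979Flux, NPB 153 (twisted boundary conditions)] -/
theorem l2_opNorm_toronOp_massless_inv_le {c : ℝ} (hc : 0 < c) {θ : Fin (d + 1) → ℝ} (hθ : ∀ μ, |θ μ| ≤ Real.pi) (hne : θ ≠ 0) :
    ‖(toronOp K c 0 (twistOf (redPhase K θ)))⁻¹‖ ≤ Real.pi ^ 2 / (4 * c * ∑ μ, (θ μ / K μ) ^ 2) := by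
  rw [l2_opNorm_toronOp_massless_inv_eq K hc hθ hne]
  have hsq : 0 < ∑ μ, (θ μ / K μ) ^ 2 := sum_sq_redPhase_pos K hne
  have hlow := holonomyGap_ge_sq K hc.le hθ
  have hpos : 0 < 4 * c / Real.pi ^ 2 * ∑ μ, (θ μ / K μ) ^ 2 := by positivity
  calc (holonomyGap K c θ)⁻¹ ≤ (4 * c / Real.pi ^ 2 * ∑ μ, (θ μ / K μ) ^ 2)⁻¹ := inv_anti₀ hpos hlow
    _ = Real.pi ^ 2 / (4 * c * ∑ μ, (θ μ / K μ) ^ 2) := by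
        have hπ : Real.pi ^ 2 ≠ 0 := by positivity
        field_simp

open scoped Matrix.Norms.L2Operator in
/-- ★★ INFRARED LOWER BOUND: `1∕(cΣ_μ(θ_μ∕K_μ)²) ≤ ‖(−cΔ_ω)⁻¹‖` (`θ ≠ 0` reduced, `c > 0`): the massless toron covariance is at least of size `(K∕θ)²∕c` — it blows up exactly
quadratically as the holonomy is switched off. [cite: tHooft1979Flux, NPB 153 (twisted boundary conditions); King1986, (4.4) p.670] -/
theorem l2_opNorm_toronOp_massless_inv_ge {c : ℝ} (hc : 0 < c) {θ : Fin (d + 1) → ℝ} (hθ : ∀ μ, |θ μ| ≤ Real.pi) (hne : θ ≠ 0) :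
    (c * ∑ μ, (θ μ / K μ) ^ 2)⁻¹ ≤ ‖(toronOp K c 0 (twistOf (redPhase K θ)))⁻¹‖ := by
  rw [l2_opNorm_toronOp_massless_inv_eq K hc hθ hne]
  exact inv_anti₀ ((holonomyGap_pos_iff K hc hθ).mpr hne) (holonomyGap_le_sq K hc.le θ)

end OpNorm

/-! ## §4 The spectrum: the constants carry the lowest eigenvalue -/

section Spectrum

/-- ★ THE CONSTANTS ARE AN EIGENVECTOR of the toron operator with eigenvalue `m² + holonomyGap` (constant gauge). [cite: King1986, (4.4) p.670] -/
theorem hasEigenvector_toronOp_const (c m2 : ℝ) (θ : Fin (d + 1) → ℝ) :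
    Module.End.HasEigenvector (Matrix.toLin' (toronOp K c m2 (twistOf (redPhase K θ)))) (((m2 + holonomyGap K c θ : ℝ)) : ℂ) (fun _ => (1 : ℂ)) := by
  refine ⟨Module.End.mem_eigenspace_iff.mpr ?_, fun h => one_ne_zero (congr_fun h (0 : Tor K))⟩
  rw [Matrix.toLin'_apply, toronOp_mulVec_one]

/-- `m² + holonomyGap` IS an eigenvalue of the toron operator. [cite: King1986, (4.4) p.670] -/
theorem hasEigenvalue_toronOp_gap (c m2 : ℝ) (θ : Fin (d + 1) → ℝ) :
    Module.End.HasEigenvalue (Matrix.toLin' (toronOp K c m2 (twistOf (redPhase K θ)))) (((m2 + holonomyGap K c θ : ℝ)) : ℂ) :=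
  Module.End.hasEigenvalue_of_hasEigenvector (hasEigenvector_toronOp_const K c m2 θ)

/-- ★★ **EVERY EIGENVALUE OF THE TORON OPERATOR IS `≥ m² + holonomyGap`** (reduced angles, `c ≥ 0`; Mathlib's `IsHermitian.eigenvalues`) — and by the previous theorem the bound
is attained: `λ_min(−cΔ_ω + m²) = m² + 2cΣ_μ(1 − cos(θ_μ∕K_μ))`. [cite: DodziukMathai2006, §1 Cor 1.3; King1986, (4.4) p.670] -/
theorem eigenvalues_toronOp_ge {c : ℝ} (hc : 0 ≤ c) (m2 : ℝ) {θ : Fin (d + 1) → ℝ} (hθ : ∀ μ, |θ μ| ≤ Real.pi) (i : Tor K) :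
    m2 + holonomyGap K c θ ≤ (toronOp_isHermitian K c m2 (twistOf (redPhase K θ))).eigenvalues i := by
  set hA := toronOp_isHermitian K c m2 (twistOf (redPhase K θ))
  rw [hA.eigenvalues_eq i]
  have h := form_toronOp_ge_holonomyGap K hc m2 hθ (⇑(hA.eigenvectorBasis i))
  have hnorm : ‖(toLp 2 (⇑(hA.eigenvectorBasis i)) : EuclideanSpace ℂ (Tor K))‖ = 1 := hA.eigenvectorBasis.orthonormal.1 i
  rw [sum_norm_sq_eq_norm_toLp_sq, hnorm, one_pow, mul_one] at h
  simpa only [RCLike.re_to_complex] using h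

end Spectrum

end Summit.QuantumFields.YangMills.BalabanUVNodes.N15KingModelRung.Toron

end
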